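import Summits.QuantumFields.BalabanUV.Beta.GAN24.SlotMomentExitPairOfSourcePairing
import Summits.QuantumFields.BalabanUV.Beta.GAN24.EdgePotentialAxialGauge

/-!
# `BalabanUV.Beta.GAN24.ExplicitSourceFormLambdaShare` — binder row G-an2-4 ∕ (CONV-C), the (S) row «(S) := (INV-X-geo) ∘ (W-γ)» (RULING R-gan24p1-g27-1 B (viii)),
# EXIT⊗EXIT class, LEVELS `j + 1 ≥ 1`: **(ΛS) — THE Λ-SHARE OF THE EXPLICIT SOURCE FORM `n⋆` VANISHES, EVERY `α ≠ β`, EVERY IN-BLOCK ROOT: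
# `𝒬_{Lc}(σ_{1_{B(y)}} ⊙ n⋆) κ w = 0`, so the ONE displayed identity of road-P2 g43's `SlotMomentExitPairOfSourcePairing` loses its Λ-term**
# (G-an2-4 CRUX TEAM (2), seat `b2b-balaban-gan24-p2` = road-P2 chair, gen 44, INTENT 1; ENGINE E-p2-g43-1 (exact rational arithmetic, any root) as a theorem)

NOT IN PRINT; OUR BOOKKEEPING ([folklore] finite lattice bookkeeping BY NAME: leaf-06 g47 FILE D `ExitDefectContourSums.contourSum_bondSum_blockInd_eq_zero` (the contour sums of
`σ_{1_{B(y)}} ⊙ n` vanish for a contour-free form whose non-exit bonds carry transverse values), FILE E `EdgePotentialAxialGauge` §2 (the comb-free representative `m̃_ab − dz μ` for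
`a < b`: `combFreeEdgePotential_apply ∕ _comb_zero`, `resid_add_unitVec`), g46 `EdgePlaquettePotential.edgePotential_apply`, FILE A `CombFreeGaugeLegCharges.axialGaugeAt_of_comb_zero ∕
axProjAt_eq_self_of_comb_zero`, FILE C `GaugeReadExitPairing.contourSum_sourceForm_eq_zero ∕ not_isCombBondAt_of_exit`, an1∕an2 `RootedComb.axProjAt_apply ∕ treeGaugeAt_eq_zero_of_axialGaugeAt`,
`AveragingContours.axial_sum_sub ∕ axial_sum_grad`, `axProjAt_eq_zero_of_isCombBond`, road-P2 g43 `WardGammaExitExplicitPotential.explicitPotential_add_zsmul` and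
`SlotMomentExitPairOfSourcePairing.moments_sigmaPair_exit_succ_of_reducedPairing`; 0 `def`, 0 cited fact, 0 `def … : Prop`, 0 sorry).
HONEST FRAMING (cell contract, verbatim): «discharging `BetaPertH` makes Bałaban's UV stability UNCONDITIONAL — a real constructive-QFT result; it is NOT the continuum limit and NOT
the Clay problem.»  HONEST DEPENDENCY (verbatim): «continuum YM on T⁴ ⇐ BetaPertH ∧ nine spine estimates (0/9 proved); BetaPertH ⇐ (D1) ∧ (D4) ∧ CAP+tail; G-an2-4 gates asym,
D1 and NE2/3/4.»

THE OBJECTS.  `m̃_ab` the edge potential in closed `ite` form (`m̃ l x = [l=a]·Lc⁻²·t_b(x) − [l=b]·Lc⁻¹·𝟙^{exit}_b(x)·t_a(x)`, `t_c(x) = x_c % Lc`, `𝟙^{exit}_c(x) = [x_c % Lc = Lc−1]`,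
`a ≠ b`; leaf-06 g46 `EdgePlaquettePotential`, road-P2 g43 `WardGammaExitExplicitPotential`); `Π^ρ = axProjAt (toSite r) Lc` the rooted comb projector (root `r ∈ box`); the explicit
potential `m⋆_c = c·Π^ρ m̃` and its source form `n⋆ κ u = Π^ρ m⋆_c κ u − Lc^{−(d+1)}·𝒬_{Lc} m⋆_c κ 0·𝟙^{exit}_κ(u)`; the Λ-share weight `σ_{1_{B(y)}}(κ,u) = 1_{B(y)}(u) + 1_{B(y)}(u+e_κ)`.
* §1 **`axProjAt_edgePotentialIte_apply_of_lt ∕ _of_gt`** — THE ROOTED PROJECTION OF THE EDGE POTENTIAL IN CLOSED FORM, BOTH COMB ORDERS.  `a < b`: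
  `Π^ρ m̃_ab l x = [l=a]·Lc⁻¹t_b𝟙^{exit}_a − [l=b]·(Lc⁻¹r_a𝟙^{exit}_b + Lc⁻²(t_a − r_a))` — leaf-06 FILE E's comb-free representative `m̃ − dz μ`, `μ = Lc⁻²t_b(t_a − r_a)`, IS the projection
  (the tree gauge of a comb-free form vanishes; `λ^ρ_{m̃} = λ^ρ_{m̃ − dzμ} + λ^ρ_{dzμ} = μ − μ(root) = μ`).  `b < a` (the comb moves the higher axis `a` FIRST, so on the `a`-segment the lower
  coordinate `b` sits at the root): the representative is `m̃ − dz μ′`, `μ′ = Lc⁻²r_b(t_a − r_a)` (`combFreeEdgePotentialGt_apply ∕ _comb_zero`), and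
  `Π^ρ m̃_ab l x = [l=a]·(Lc⁻²(t_b − r_b) + Lc⁻¹r_b𝟙^{exit}_a) − [l=b]·Lc⁻¹𝟙^{exit}_b t_a`.
* §2 **`axProjAt_edgePotentialIte_transverse`** — every `a ≠ b`, every `κ`: the NON-EXIT `κ`-bonds of `Π^ρ m̃_ab` carry a value depending only on the coordinates transverse to `κ`
  (FILE D's hypothesis); `axProjAt_explicitPotential_eq_self` (the outer `Π^ρ` fixes `m⋆_c`, which is comb-free).
* §3 **`contourSum_bondSum_blockInd_explicitSourceForm_eq_zero`** — (ΛS): `𝒬_{Lc}(σ_{1_{B(y)}} ⊙ n⋆) κ w = 0` for every `κ w y c`, `n⋆` LITERALLY as in road-P2 g43 (5.2)'s `hX`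
  (FILE D at `g := c·g_κ`, `𝒬 n⋆ = 0` by `contourSum_sourceForm_eq_zero` ⨾ `explicitPotential_add_zsmul`).  ENGINE E-p2-g43-1 found this in exact arithmetic for `d+1 = 2, 3`,
  `Lc = 3, 4, 5`, all roots; here it is a theorem for every `d`, `Lc ≥ 1`, `r ∈ box`.
* §4 **`moments_sigmaPair_exit_succ_of_columnPairing`** — road-P2 g43 (5.2) §2 `moments_sigmaPair_exit_succ_of_reducedPairing` WITH THE Λ-TERM DROPPED: the (S) row at level `j+1`
  for the exit⊗exit σ-pair (centred root, `Lc` odd, `α ≠ β`) follows from the ONE identity «`(cE·wE_{j+1})·X_{j+1}(n⋆, 1_{B(y)}; ν, y′) = −½(stepScale_{j+1}·Lc^{d+1})·R_end-sum`»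
  (leaf-06 g48 ENGINE E29 ∕ g49 R1: expected exactly at the pin `cE = Lc^{d+1}`; mechanism (C2′)) — NOT a theorem here.
Asserts NO value of any resolvent column; (W-γ) at levels `≥ 1` ∕ (S) ∕ (INV) ∕ (Π) NOT claimed unconditionally above level 0; NOTHING of (Q-R) ∕ (DL) ∕ (LT) ∕ «T2Shape» ∕ (hW, hWall)
discharged; NEVER «G-an2-4 closed» as (CONV-C); NOT D1, NOT `BetaPertH`, NOT continuum, NOT Clay.  2026-08-23; no existing file touched.
-/

noncomputable section

open Finset
open scoped BigOperators
open Literature.MathematicalPhysics.QuantumFieldTheory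
open Literature.MathematicalPhysics.QuantumFieldTheory.Balaban1983to89
open Literature.MathematicalPhysics.QuantumFieldTheory.Balaban1983to89.Beta
open ExpKernelCalculus (Site MKer comp)
open AffineAveraging (Form0 Form1 box toSite unitVec unitVec_apply dz contourSum)
open AveragingContours (blk axial axial_sum_sub axial_sum_grad grad_eq_dz)
open AveragingContoursRooted (treeGaugeAt ctrOff ctrOff_mem_box)
open RootedComb (axProjAt axProjAt_apply treeGaugeAt_eq_zero_of_axialGaugeAt)
open KernelSpecInstance (wΦ)
open OneStepResolventKernel (Fib)
open OneStepKernelFamily (KInvStep colH)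
open SecondOrderResponse (colM dM)
open BalabanStepW2 (wM1)
open BalabanStepJetsSucc (wE wVH)
open Summit.QuantumFields.BalabanUV.Beta.BorderedHessian (stepScale)
open Summit.QuantumFields.BalabanUV.Beta.AxialDressingRooted (IsCombBondAt coDressKBmAt axProjAt_eq_zero_of_isCombBond one_le_of_neZero)
open Summit.QuantumFields.BalabanUV.Beta.SpineRooted (SpureRecAt M1At e3OfK)
open Summit.QuantumFields.BalabanUV.Beta.WardLocusRecursive (SrecAt)
open Summit.QuantumFields.BalabanUV.Beta.KernelWardRelative (gaugeWt)
open Summit.QuantumFields.BalabanUV.Beta.GAN24.CombFreeGaugeLegCharges (axialGaugeAt_of_comb_zero axProjAt_eq_self_of_comb_zero)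
open Summit.QuantumFields.BalabanUV.Beta.GAN24.EdgePlaquettePotential (edgePotential_apply)
open Summit.QuantumFields.BalabanUV.Beta.GAN24.EdgePotentialAxialGauge (resid_add_unitVec combFreeEdgePotential_apply combFreeEdgePotential_comb_zero)
open Summit.QuantumFields.BalabanUV.Beta.GAN24.GaugeReadExitPairing (contourSum_sourceForm_eq_zero not_isCombBondAt_of_exit)
open Summit.QuantumFields.BalabanUV.Beta.GAN24.ExitDefectContourSums (contourSum_bondSum_blockInd_eq_zero)
open Summit.QuantumFields.BalabanUV.Beta.GAN24.WardGammaExitExplicitPotential (explicitPotential_add_zsmul)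
open Summit.QuantumFields.BalabanUV.Beta.GAN24.SlotMomentExitPairOfSourcePairing (moments_sigmaPair_exit_succ_of_reducedPairing)

namespace Summit.QuantumFields.BalabanUV.Beta.GAN24.ExplicitSourceFormLambdaShare

variable {d : ℕ}

/-! ## §0 Two lattice helpers: the residue of a root coordinate; the tree gauge of a form with a comb-free gauge-shift -/

/-- [folklore] At the root `Lc•blk z + toSite r` of the block of `z` every residue is the root offset: `(Lc•blk z + toSite r)_c % Lc = r_c` (`r ∈ box`). -/
theorem root_emod {Lc : ℕ} {r : Fin (d + 1) → ℕ} (hr : r ∈ box (d + 1) Lc) (c : Fin (d + 1)) (z : Site (d + 1)) :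
    ((Lc : ℤ) • blk Lc z + toSite r) c % (Lc : ℤ) = (r c : ℤ) := by
  have hrc : r c < Lc := Finset.mem_range.1 (Fintype.mem_piFinset.1 hr c)
  simp only [Pi.add_apply, Pi.smul_apply, smul_eq_mul, AffineAveraging.toSite]
  rw [add_comm, Int.add_mul_emod_self_left, Int.emod_eq_of_lt (by positivity) (by exact_mod_cast hrc)]

/-- [folklore] **THE TREE GAUGE OF `F` WHEN `F − dz μ` IS COMB-FREE AND `μ` VANISHES AT THE ROOTS IS `μ`** (in-block root, `1 ≤ Lc`): `λ^ρ_F = λ^ρ_{F − dzμ} + λ^ρ_{dzμ}`, the first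
vanishes (a comb-free form is rooted-axial, `treeGaugeAt_eq_zero_of_axialGaugeAt`), the second telescopes to `μ − μ(root) = μ` (`axial_sum_grad`). -/
theorem treeGaugeAt_eq_of_comb_zero_sub_dz {Lc : ℕ} (hLc : 1 ≤ Lc) {r : Fin (d + 1) → ℕ} (hr : r ∈ box (d + 1) Lc) {F : Form1 (d + 1) ℝ} {μ : Site (d + 1) → ℝ}
    (hG : ∀ κ u, IsCombBondAt (toSite r) Lc κ u → F κ u - dz μ κ u = 0) (hμ : ∀ z : Site (d + 1), μ ((Lc : ℤ) • blk Lc z + toSite r) = 0) (z : Site (d + 1)) :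
    treeGaugeAt (toSite r) F Lc z = μ z := by
  have hT0 : treeGaugeAt (toSite r) (F - dz μ) Lc = 0 :=
    treeGaugeAt_eq_zero_of_axialGaugeAt hLc (axialGaugeAt_of_comb_zero hLc hr (f := F - dz μ) fun κ u h => by
      rw [Pi.sub_apply, Pi.sub_apply]; exact hG κ u h)
  have h1 : treeGaugeAt (toSite r) (F - dz μ) Lc z = treeGaugeAt (toSite r) F Lc z - treeGaugeAt (toSite r) (dz μ) Lc z := by
    unfold AveragingContoursRooted.treeGaugeAt
    exact axial_sum_sub F (dz μ) _ z
  have h2 : treeGaugeAt (toSite r) (dz μ) Lc z = μ z - μ ((Lc : ℤ) • blk Lc z + toSite r) := by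
    unfold AveragingContoursRooted.treeGaugeAt
    rw [← grad_eq_dz]
    exact axial_sum_grad μ _ z
  have h3 := congrFun hT0 z
  rw [Pi.zero_apply, h1, h2, hμ z, sub_zero] at h3
  linarith

/-- [folklore] **HENCE `Π^ρ F = F − dz μ` POINTWISE** under the same two hypotheses (`axProjAt_apply`). -/
theorem axProjAt_apply_of_comb_zero_sub_dz {Lc : ℕ} (hLc : 1 ≤ Lc) {r : Fin (d + 1) → ℕ} (hr : r ∈ box (d + 1) Lc) {F : Form1 (d + 1) ℝ} {μ : Site (d + 1) → ℝ}
    (hG : ∀ κ u, IsCombBondAt (toSite r) Lc κ u → F κ u - dz μ κ u = 0) (hμ : ∀ z : Site (d + 1), μ ((Lc : ℤ) • blk Lc z + toSite r) = 0)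
    (l : Fin (d + 1)) (x : Site (d + 1)) :
    axProjAt (toSite r) Lc F l x = F l x - dz μ l x := by
  rw [axProjAt_apply, treeGaugeAt_eq_of_comb_zero_sub_dz hLc hr hG hμ, treeGaugeAt_eq_of_comb_zero_sub_dz hLc hr hG hμ]
  rfl

/-! ## §1 The rooted projection of the edge potential in closed form, both comb orders -/

/-- NOT IN PRINT; OUR BOOKKEEPING.  **`Π^ρ m̃_ab` IN CLOSED FORM, `a < b`** (in-block root `toSite r`, `1 ≤ Lc`): the projection IS leaf-06 FILE E's comb-free representative
`m̃_ab − dz μ`, `μ = Lc⁻²·t_b·(t_a − r_a)`: `Π^ρ m̃_ab l x = [l=a]·Lc⁻¹·t_b(x)·𝟙^{exit}_a(x) − [l=b]·(Lc⁻¹·r_a·𝟙^{exit}_b(x) + Lc⁻²·(t_a(x) − r_a))`. -/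
theorem axProjAt_edgePotentialIte_apply_of_lt {Lc : ℕ} (hLc : 1 ≤ Lc) {r : Fin (d + 1) → ℕ} (hr : r ∈ box (d + 1) Lc) {a b : Fin (d + 1)} (hab : a < b)
    (l : Fin (d + 1)) (x : Site (d + 1)) :
    axProjAt (toSite r) Lc (fun l x => (if l = a then ((Lc : ℝ) ^ 2)⁻¹ * (((x b % (Lc : ℤ) : ℤ)) : ℝ) else 0)
        - (if l = b then (Lc : ℝ)⁻¹ * (if x b % (Lc : ℤ) = (Lc : ℤ) - 1 then (1 : ℝ) else 0) * (((x a % (Lc : ℤ) : ℤ)) : ℝ) else 0)) l x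
      = (if l = a then (Lc : ℝ)⁻¹ * (((x b % (Lc : ℤ) : ℤ)) : ℝ) * (if x a % (Lc : ℤ) = (Lc : ℤ) - 1 then (1 : ℝ) else 0) else 0)
        - (if l = b then (Lc : ℝ)⁻¹ * (r a : ℝ) * (if x b % (Lc : ℤ) = (Lc : ℤ) - 1 then (1 : ℝ) else 0)
            + ((Lc : ℝ) ^ 2)⁻¹ * ((((x a % (Lc : ℤ) : ℤ)) : ℝ) - (r a : ℝ)) else 0) := by
  have hG : ∀ κ u, IsCombBondAt (toSite r) Lc κ u →
      (fun l x => (if l = a then ((Lc : ℝ) ^ 2)⁻¹ * (((x b % (Lc : ℤ) : ℤ)) : ℝ) else 0)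
        - (if l = b then (Lc : ℝ)⁻¹ * (if x b % (Lc : ℤ) = (Lc : ℤ) - 1 then (1 : ℝ) else 0) * (((x a % (Lc : ℤ) : ℤ)) : ℝ) else 0) : Form1 (d + 1) ℝ) κ u
        - dz (fun z : Site (d + 1) => ((Lc : ℝ) ^ 2)⁻¹ * (((z b % (Lc : ℤ) : ℤ)) : ℝ) * ((((z a % (Lc : ℤ) : ℤ)) : ℝ) - (r a : ℝ))) κ u = 0 := by
    intro κ u h
    have h0 := combFreeEdgePotential_comb_zero hLc hr hab h
    rw [edgePotential_apply hLc hab.ne κ u] at h0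
    exact h0
  have hμ : ∀ z : Site (d + 1), (fun z : Site (d + 1) => ((Lc : ℝ) ^ 2)⁻¹ * (((z b % (Lc : ℤ) : ℤ)) : ℝ) * ((((z a % (Lc : ℤ) : ℤ)) : ℝ) - (r a : ℝ)))
      ((Lc : ℤ) • blk Lc z + toSite r) = 0 := by
    intro z
    show ((Lc : ℝ) ^ 2)⁻¹ * (((((Lc : ℤ) • blk Lc z + toSite r) b % (Lc : ℤ) : ℤ)) : ℝ) * (((((((Lc : ℤ) • blk Lc z + toSite r) a % (Lc : ℤ) : ℤ)) : ℝ) - (r a : ℝ))) = 0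
    rw [root_emod hr a z]
    push_cast
    ring
  rw [axProjAt_apply_of_comb_zero_sub_dz hLc hr hG hμ l x]
  have h4 := combFreeEdgePotential_apply hLc r hab.ne l x
  rw [edgePotential_apply hLc hab.ne l x] at h4
  exact h4

/-- NOT IN PRINT; OUR BOOKKEEPING.  **THE COMB-FREE REPRESENTATIVE FOR THE OTHER COMB ORDER, IN CLOSED FORM** (`a ≠ b`, `1 ≤ Lc`): with `μ′(x) := Lc⁻²·r_b·(t_a(x) − r_a)`,
`(m̃_ab − dz μ′) l x = [l=a]·(Lc⁻²·(t_b(x) − r_b) + Lc⁻¹·r_b·𝟙^{exit}_a(x)) − [l=b]·Lc⁻¹·𝟙^{exit}_b(x)·t_a(x)` (`resid_add_unitVec`: `t_a` steps by `1 − Lc·𝟙^{exit}_a` along `a` only). -/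
theorem combFreeEdgePotentialGt_apply {Lc : ℕ} (hLc : 1 ≤ Lc) (r : Fin (d + 1) → ℕ) {a b : Fin (d + 1)} (hab : a ≠ b) (l : Fin (d + 1)) (x : Site (d + 1)) :
    ((if l = a then ((Lc : ℝ) ^ 2)⁻¹ * (((x b % (Lc : ℤ) : ℤ)) : ℝ) else 0)
        - (if l = b then (Lc : ℝ)⁻¹ * (if x b % (Lc : ℤ) = (Lc : ℤ) - 1 then (1 : ℝ) else 0) * (((x a % (Lc : ℤ) : ℤ)) : ℝ) else 0))
      - dz (fun z : Site (d + 1) => ((Lc : ℝ) ^ 2)⁻¹ * (r b : ℝ) * ((((z a % (Lc : ℤ) : ℤ)) : ℝ) - (r a : ℝ))) l x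
      = (if l = a then ((Lc : ℝ) ^ 2)⁻¹ * ((((x b % (Lc : ℤ) : ℤ)) : ℝ) - (r b : ℝ))
            + (Lc : ℝ)⁻¹ * (r b : ℝ) * (if x a % (Lc : ℤ) = (Lc : ℤ) - 1 then (1 : ℝ) else 0) else 0)
        - (if l = b then (Lc : ℝ)⁻¹ * (if x b % (Lc : ℤ) = (Lc : ℤ) - 1 then (1 : ℝ) else 0) * (((x a % (Lc : ℤ) : ℤ)) : ℝ) else 0) := by
  have hL0 : (Lc : ℝ) ≠ 0 := by exact_mod_cast (show Lc ≠ 0 by omega)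
  simp only [AffineAveraging.dz]
  rw [resid_add_unitVec hLc a l x]
  by_cases hla : l = a
  · subst hla
    rw [if_pos rfl, if_pos rfl, if_neg hab, if_pos rfl]
    field_simp
    ring
  · rw [if_neg hla, if_neg hla, if_neg hla]
    ring

/-- NOT IN PRINT; OUR BOOKKEEPING.  **`m̃_ab − dz μ′` VANISHES ON THE COMB BONDS when `b < a`** (`r ∈ box`): a comb bond never exits its block, and on a comb bond of direction `a` the
LOWER coordinate `b` sits at the root, `t_b = r_b` (the comb moves the higher axis first). -/
theorem combFreeEdgePotentialGt_comb_zero {Lc : ℕ} (hLc : 1 ≤ Lc) {r : Fin (d + 1) → ℕ} (hr : r ∈ box (d + 1) Lc) {a b : Fin (d + 1)} (hba : b < a)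
    {l : Fin (d + 1)} {x : Site (d + 1)} (h : IsCombBondAt (toSite r) Lc l x) :
    ((if l = a then ((Lc : ℝ) ^ 2)⁻¹ * (((x b % (Lc : ℤ) : ℤ)) : ℝ) else 0)
        - (if l = b then (Lc : ℝ)⁻¹ * (if x b % (Lc : ℤ) = (Lc : ℤ) - 1 then (1 : ℝ) else 0) * (((x a % (Lc : ℤ) : ℤ)) : ℝ) else 0))
      - dz (fun z : Site (d + 1) => ((Lc : ℝ) ^ 2)⁻¹ * (r b : ℝ) * ((((z a % (Lc : ℤ) : ℤ)) : ℝ) - (r a : ℝ))) l x = 0 := by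
  rw [combFreeEdgePotentialGt_apply hLc r hba.ne' l x]
  have hne : ¬ (x l % (Lc : ℤ) = (Lc : ℤ) - 1) := fun hx => not_isCombBondAt_of_exit hLc (toSite r) hx h
  by_cases hla : l = a
  · subst hla
    rw [if_pos rfl, if_neg hne, if_neg hba.ne', mul_zero, add_zero, sub_zero]
    have hxb : x b = ((Lc : ℤ) • blk Lc x) b + toSite r b := h.1 b hba
    have e : x b % (Lc : ℤ) = (r b : ℤ) := by
      have := root_emod hr b x
      rwa [Pi.add_apply, ← hxb] at this
    rw [e]
    push_cast
    ring
  · rw [if_neg hla, zero_sub, neg_eq_zero]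
    by_cases hlb : l = b
    · subst hlb
      rw [if_pos rfl, if_neg hne, mul_zero, zero_mul]
    · rw [if_neg hlb]

/-- NOT IN PRINT; OUR BOOKKEEPING.  **`Π^ρ m̃_ab` IN CLOSED FORM, `b < a`** (in-block root `toSite r`, `1 ≤ Lc`):
`Π^ρ m̃_ab l x = [l=a]·(Lc⁻²·(t_b(x) − r_b) + Lc⁻¹·r_b·𝟙^{exit}_a(x)) − [l=b]·Lc⁻¹·𝟙^{exit}_b(x)·t_a(x)` (§0 at the representative `m̃ − dz μ′`; `μ′ = 0` at the roots). -/
theorem axProjAt_edgePotentialIte_apply_of_gt {Lc : ℕ} (hLc : 1 ≤ Lc) {r : Fin (d + 1) → ℕ} (hr : r ∈ box (d + 1) Lc) {a b : Fin (d + 1)} (hba : b < a)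
    (l : Fin (d + 1)) (x : Site (d + 1)) :
    axProjAt (toSite r) Lc (fun l x => (if l = a then ((Lc : ℝ) ^ 2)⁻¹ * (((x b % (Lc : ℤ) : ℤ)) : ℝ) else 0)
        - (if l = b then (Lc : ℝ)⁻¹ * (if x b % (Lc : ℤ) = (Lc : ℤ) - 1 then (1 : ℝ) else 0) * (((x a % (Lc : ℤ) : ℤ)) : ℝ) else 0)) l x
      = (if l = a then ((Lc : ℝ) ^ 2)⁻¹ * ((((x b % (Lc : ℤ) : ℤ)) : ℝ) - (r b : ℝ))
            + (Lc : ℝ)⁻¹ * (r b : ℝ) * (if x a % (Lc : ℤ) = (Lc : ℤ) - 1 then (1 : ℝ) else 0) else 0)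
        - (if l = b then (Lc : ℝ)⁻¹ * (if x b % (Lc : ℤ) = (Lc : ℤ) - 1 then (1 : ℝ) else 0) * (((x a % (Lc : ℤ) : ℤ)) : ℝ) else 0) := by
  have hG : ∀ κ u, IsCombBondAt (toSite r) Lc κ u →
      (fun l x => (if l = a then ((Lc : ℝ) ^ 2)⁻¹ * (((x b % (Lc : ℤ) : ℤ)) : ℝ) else 0)
        - (if l = b then (Lc : ℝ)⁻¹ * (if x b % (Lc : ℤ) = (Lc : ℤ) - 1 then (1 : ℝ) else 0) * (((x a % (Lc : ℤ) : ℤ)) : ℝ) else 0) : Form1 (d + 1) ℝ) κ u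
        - dz (fun z : Site (d + 1) => ((Lc : ℝ) ^ 2)⁻¹ * (r b : ℝ) * ((((z a % (Lc : ℤ) : ℤ)) : ℝ) - (r a : ℝ))) κ u = 0 :=
    fun κ u h => combFreeEdgePotentialGt_comb_zero hLc hr hba h
  have hμ : ∀ z : Site (d + 1), (fun z : Site (d + 1) => ((Lc : ℝ) ^ 2)⁻¹ * (r b : ℝ) * ((((z a % (Lc : ℤ) : ℤ)) : ℝ) - (r a : ℝ)))
      ((Lc : ℤ) • blk Lc z + toSite r) = 0 := by
    intro z
    show ((Lc : ℝ) ^ 2)⁻¹ * (r b : ℝ) * (((((((Lc : ℤ) • blk Lc z + toSite r) a % (Lc : ℤ) : ℤ)) : ℝ) - (r a : ℝ))) = 0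
    rw [root_emod hr a z]
    push_cast
    ring
  rw [axProjAt_apply_of_comb_zero_sub_dz hLc hr hG hμ l x]
  exact combFreeEdgePotentialGt_apply hLc r hba.ne' l x

/-! ## §2 The non-exit bonds of `Π^ρ m̃_ab` carry transverse values; the outer projector fixes the explicit potential -/

/-- NOT IN PRINT; OUR BOOKKEEPING.  **THE NON-EXIT `κ`-BONDS OF `Π^ρ m̃_ab` CARRY TRANSVERSE VALUES, EVERY `a ≠ b`, EVERY `κ`** (in-block root, `1 ≤ Lc`): there is `g_κ` with
`Π^ρ m̃_ab κ z = g_κ(update z κ 0)` whenever `z_κ % Lc ≠ Lc − 1` — by §1: for `a < b` the only non-exit value is `−Lc⁻²(t_a − r_a)` in direction `b`; for `b < a` it is `Lc⁻²(t_b − r_b)`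
in direction `a` (FILE D `contourSum_bondSum_blockInd_eq_zero`'s hypothesis). -/
theorem axProjAt_edgePotentialIte_transverse {Lc : ℕ} (hLc : 1 ≤ Lc) {r : Fin (d + 1) → ℕ} (hr : r ∈ box (d + 1) Lc) {a b : Fin (d + 1)} (hab : a ≠ b) (κ : Fin (d + 1)) :
    ∃ g : Site (d + 1) → ℝ, ∀ z : Site (d + 1), z κ % (Lc : ℤ) ≠ (Lc : ℤ) - 1 →
      axProjAt (toSite r) Lc (fun l x => (if l = a then ((Lc : ℝ) ^ 2)⁻¹ * (((x b % (Lc : ℤ) : ℤ)) : ℝ) else 0)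
        - (if l = b then (Lc : ℝ)⁻¹ * (if x b % (Lc : ℤ) = (Lc : ℤ) - 1 then (1 : ℝ) else 0) * (((x a % (Lc : ℤ) : ℤ)) : ℝ) else 0)) κ z
        = g (Function.update z κ 0) := by
  rcases lt_or_gt_of_ne hab with h | h
  · -- `a < b`: the representative of FILE E
    by_cases hκb : κ = b
    · subst hκb
      refine ⟨fun w => -(((Lc : ℝ) ^ 2)⁻¹ * ((((w a % (Lc : ℤ) : ℤ)) : ℝ) - (r a : ℝ))), fun z hz => ?_⟩
      rw [axProjAt_edgePotentialIte_apply_of_lt hLc hr h κ z, if_neg (Ne.symm hab), if_pos rfl, if_neg hz]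
      show _ = -(((Lc : ℝ) ^ 2)⁻¹ * ((((Function.update z κ 0 a % (Lc : ℤ) : ℤ)) : ℝ) - (r a : ℝ)))
      rw [Function.update_of_ne hab]
      ring
    · refine ⟨fun _ => 0, fun z hz => ?_⟩
      rw [axProjAt_edgePotentialIte_apply_of_lt hLc hr h κ z, if_neg hκb]
      by_cases hκa : κ = a
      · subst hκa; rw [if_pos rfl, if_neg hz]; ring
      · rw [if_neg hκa]; ring
  · -- `b < a`: the representative `m̃ − dz μ′`
    by_cases hκa : κ = a
    · subst hκa
      refine ⟨fun w => ((Lc : ℝ) ^ 2)⁻¹ * ((((w b % (Lc : ℤ) : ℤ)) : ℝ) - (r b : ℝ)), fun z hz => ?_⟩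
      rw [axProjAt_edgePotentialIte_apply_of_gt hLc hr h κ z, if_pos rfl, if_neg hab, if_neg hz]
      show _ = ((Lc : ℝ) ^ 2)⁻¹ * ((((Function.update z κ 0 b % (Lc : ℤ) : ℤ)) : ℝ) - (r b : ℝ))
      rw [Function.update_of_ne (Ne.symm hab)]
      ring
    · refine ⟨fun _ => 0, fun z hz => ?_⟩
      rw [axProjAt_edgePotentialIte_apply_of_gt hLc hr h κ z, if_neg hκa]
      by_cases hκb : κ = b
      · subst hκb; rw [if_pos rfl, if_neg hz]; ring
      · rw [if_neg hκb]; ring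

/-- [folklore] **THE OUTER PROJECTOR FIXES THE EXPLICIT POTENTIAL**: `Π^ρ(c·Π^ρ m̃) = c·Π^ρ m̃` — `c·Π^ρ m̃` vanishes on the comb bonds (`axProjAt_eq_zero_of_isCombBond`), hence is fixed
(FILE A `axProjAt_eq_self_of_comb_zero`). -/
theorem axProjAt_explicitPotential_eq_self {Lc : ℕ} (hLc : 1 ≤ Lc) {r : Fin (d + 1) → ℕ} (hr : r ∈ box (d + 1) Lc) (m : Form1 (d + 1) ℝ) (c : ℝ) :
    axProjAt (toSite r) Lc (fun l v => c * axProjAt (toSite r) Lc m l v) = fun l v => c * axProjAt (toSite r) Lc m l v :=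
  axProjAt_eq_self_of_comb_zero hLc hr fun κ u h => by
    show c * axProjAt (toSite r) Lc m κ u = 0
    rw [axProjAt_eq_zero_of_isCombBond h m, mul_zero]

/-! ## §3 (ΛS): the Λ-share of the explicit source form vanishes -/

/-- NOT IN PRINT; OUR BOOKKEEPING.  **(ΛS) — THE Λ-SHARE OF THE EXPLICIT SOURCE FORM `n⋆` VANISHES** (in-block root `toSite r`, `α ≠ β`, every real `c`, every label `y`, direction `κ`,
block `w`): `𝒬_{Lc}(σ_{1_{B(y)}} ⊙ n⋆) κ w = Σ_{b∈box} Σ_{s<Lc} (1_{B(y)}(u) + 1_{B(y)}(u + e_κ))·n⋆ κ u |_{u = Lc•w + b + s•e_κ} = 0`, with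
`n⋆ κ u = Π^ρ(c·Π^ρ m̃_{αβ}) κ u − Lc^{−(d+1)}·𝒬_{Lc}(c·Π^ρ m̃_{αβ}) κ 0·𝟙^{exit}_κ(u)` LITERALLY as in road-P2 g43 (5.2) — FILE D at the transverse values of §2 (times `c`; the outer
`Π^ρ` fixed by `axProjAt_explicitPotential_eq_self`) and `𝒬 n⋆ = 0` (FILE C `contourSum_sourceForm_eq_zero` ⨾ `explicitPotential_add_zsmul`).  ENGINE E-p2-g43-1 as a theorem. -/
theorem contourSum_bondSum_blockInd_explicitSourceForm_eq_zero {Lc : ℕ} [NeZero Lc] {r : Fin (d + 1) → ℕ} (hr : r ∈ box (d + 1) Lc) {α β : Fin (d + 1)} (hαβ : α ≠ β)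
    (c : ℝ) (y : Site (d + 1)) (κ : Fin (d + 1)) (w : Site (d + 1)) :
    contourSum Lc (fun κ u => ((if blk Lc u = y then (1 : ℝ) else 0) + (if blk Lc (u + unitVec κ) = y then (1 : ℝ) else 0))
        * (axProjAt (toSite r) Lc
            (fun l v => c * axProjAt (toSite r) Lc
              (fun l x => (if l = α then ((Lc : ℝ) ^ 2)⁻¹ * (((x β % (Lc : ℤ) : ℤ)) : ℝ) else 0)
                - (if l = β then (Lc : ℝ)⁻¹ * (if x β % (Lc : ℤ) = (Lc : ℤ) - 1 then (1 : ℝ) else 0) * (((x α % (Lc : ℤ) : ℤ)) : ℝ) else 0)) l v) κ u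
          - ((Lc : ℝ) ^ (d + 1))⁻¹ * (contourSum Lc
            (fun l v => c * axProjAt (toSite r) Lc
              (fun l x => (if l = α then ((Lc : ℝ) ^ 2)⁻¹ * (((x β % (Lc : ℤ) : ℤ)) : ℝ) else 0)
                - (if l = β then (Lc : ℝ)⁻¹ * (if x β % (Lc : ℤ) = (Lc : ℤ) - 1 then (1 : ℝ) else 0) * (((x α % (Lc : ℤ) : ℤ)) : ℝ) else 0)) l v) κ 0
            * (if u κ % (Lc : ℤ) = (Lc : ℤ) - 1 then (1 : ℝ) else 0)))) κ w = 0 := by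
  have hLc : 1 ≤ Lc := one_le_of_neZero Lc
  obtain ⟨g, hg⟩ := axProjAt_edgePotentialIte_transverse hLc hr hαβ κ
  have hfix := axProjAt_explicitPotential_eq_self hLc hr
    (fun l x => (if l = α then ((Lc : ℝ) ^ 2)⁻¹ * (((x β % (Lc : ℤ) : ℤ)) : ℝ) else 0)
      - (if l = β then (Lc : ℝ)⁻¹ * (if x β % (Lc : ℤ) = (Lc : ℤ) - 1 then (1 : ℝ) else 0) * (((x α % (Lc : ℤ) : ℤ)) : ℝ) else 0)) c
  refine contourSum_bondSum_blockInd_eq_zero hLc κ w y (g := fun z => c * g z) (fun z hz => ?_)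
    (contourSum_sourceForm_eq_zero r (fun κ x v => explicitPotential_add_zsmul hαβ c κ x v) κ w)
  show axProjAt (toSite r) Lc
            (fun l v => c * axProjAt (toSite r) Lc
              (fun l x => (if l = α then ((Lc : ℝ) ^ 2)⁻¹ * (((x β % (Lc : ℤ) : ℤ)) : ℝ) else 0)
                - (if l = β then (Lc : ℝ)⁻¹ * (if x β % (Lc : ℤ) = (Lc : ℤ) - 1 then (1 : ℝ) else 0) * (((x α % (Lc : ℤ) : ℤ)) : ℝ) else 0)) l v) κ z
          - ((Lc : ℝ) ^ (d + 1))⁻¹ * (contourSum Lc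
            (fun l v => c * axProjAt (toSite r) Lc
              (fun l x => (if l = α then ((Lc : ℝ) ^ 2)⁻¹ * (((x β % (Lc : ℤ) : ℤ)) : ℝ) else 0)
                - (if l = β then (Lc : ℝ)⁻¹ * (if x β % (Lc : ℤ) = (Lc : ℤ) - 1 then (1 : ℝ) else 0) * (((x α % (Lc : ℤ) : ℤ)) : ℝ) else 0)) l v) κ 0
            * (if z κ % (Lc : ℤ) = (Lc : ℤ) - 1 then (1 : ℝ) else 0)) = c * g (Function.update z κ 0)
  rw [hfix, if_neg hz, mul_zero, mul_zero, sub_zero]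
  show c * _ = _
  rw [hg z hz]


/-! ## §4 The (S) row at level `j+1` modulo the bare column pairing of `n⋆` -/

section Srow

variable {Lc : ℕ} [NeZero Lc]

/-- NOT IN PRINT; OUR BOOKKEEPING.  **THE (S) ROW AT LEVEL `j+1` FOR THE EXIT⊗EXIT σ-PAIR MODULO THE BARE COLUMN PAIRING OF `n⋆`** (centred root, `Lc` odd, `α ≠ β`, all `cE cVH cΛ`,
every `j y ν`; the profiles `Vα ∕ Vend ∕ Qc` bound by their defining equations — instantiate with `fun _ => rfl`): road-P2 g43 (5.2) §2
`SlotMomentExitPairOfSourcePairing.moments_sigmaPair_exit_succ_of_reducedPairing` WITH THE Λ-TERM OF ITS HYPOTHESIS DROPPED by (ΛS) §3 — IF for every slot `y′` and every `c` with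
the charge identity `(cE·wE_{j+1})·X_{j+1}(n⋆, 1_{B(y)}; ν, y′) = −½(stepScale_{j+1}·Lc^{d+1})·Σ'_u Σ_κ 𝟙[blk(u+e_κ) = y]·colH G_{j+1}(ν,y′) κ u·C_{j+1}(κ,u)`
THEN `Σ'_{y′} Z(y′) = 0 ∧ ∀ λ, Σ'_{y′} (y′−y)_λ·Z(y′) = 0`, `Z = Vα − ½(stepScale_{j+1}·Lc^{d+1})⁻¹·Qc`.  The displayed identity is leaf-06's closed form of `X_{j+1}` on ONE explicit
comb-free contour-free periodic 1-form, expected exactly at the pin `cE = Lc^{d+1}` (ENGINE E29 ∕ R1; mechanism (C2′)) — NOT a theorem here. -/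
theorem moments_sigmaPair_exit_succ_of_columnPairing (hLc : Odd Lc) (cE cVH cΛ : ℝ) (j : ℕ) (y : Site (d + 1)) (ν : Fin (d + 1)) {α β : Fin (d + 1)} (hαβ : α ≠ β)
    {Vα Vend Qc : Site (d + 1) → ℝ}
    (hVα : ∀ y' : Site (d + 1), Vα y' = ((1 / 2 : ℝ) *
        ((∑ κ : Fin (d + 1), ∑' u : Site (d + 1),
            colH (coDressKBmAt (toSite (ctrOff (d + 1) Lc)) Lc (KInvStep (d := d) Lc (j + 1))) Lc ν y' κ u
              * ((if y' = y then (1 / 2 : ℝ) else 0) - (if blk Lc u = y then (1 / 2 : ℝ) else 0))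
              * ∑' xz : Site (d + 1) × Site (d + 1), ((if xz.1 α % (Lc : ℤ) = (Lc : ℤ) - 1 then (1 : ℝ) else 0) * (if xz.2 β % (Lc : ℤ) = (Lc : ℤ) - 1 then (1 : ℝ) else 0))
            * SpureRecAt d Lc (toSite (ctrOff (d + 1) Lc)) cE cVH cΛ (j + 1) κ u xz.1 xz.2 (Sum.inl α) (Sum.inl β))
          + ∑ ρ' : Fin (d + 1), ∑' w : Site (d + 1),
            colM (coDressKBmAt (toSite (ctrOff (d + 1) Lc)) Lc (KInvStep (d := d) Lc (j + 1))) Lc ν y' ρ' w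
              * ((if y' = y then (1 / 2 : ℝ) else 0) - (if w = y then (1 / 2 : ℝ) else 0))
              * ∑' xz : Site (d + 1) × Site (d + 1), ((if xz.1 α % (Lc : ℤ) = (Lc : ℤ) - 1 then (1 : ℝ) else 0) * (if xz.2 β % (Lc : ℤ) = (Lc : ℤ) - 1 then (1 : ℝ) else 0))
            * M1At d Lc (toSite (ctrOff (d + 1) Lc)) cΛ (j + 1) ρ' w xz.1 xz.2 (Sum.inl α) (Sum.inl β))))
    (hVend : ∀ y' : Site (d + 1), Vend y' = ((1 / 2 : ℝ) *
        ((∑ κ : Fin (d + 1), ∑' u : Site (d + 1),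
            colH (coDressKBmAt (toSite (ctrOff (d + 1) Lc)) Lc (KInvStep (d := d) Lc (j + 1))) Lc ν y' κ u
              * ((if y' + Pi.single ν 1 = y then (1 / 2 : ℝ) else 0) - (if blk Lc (u + Pi.single κ 1) = y then (1 / 2 : ℝ) else 0))
              * ∑' xz : Site (d + 1) × Site (d + 1), ((if xz.1 α % (Lc : ℤ) = (Lc : ℤ) - 1 then (1 : ℝ) else 0) * (if xz.2 β % (Lc : ℤ) = (Lc : ℤ) - 1 then (1 : ℝ) else 0))
            * SpureRecAt d Lc (toSite (ctrOff (d + 1) Lc)) cE cVH cΛ (j + 1) κ u xz.1 xz.2 (Sum.inl α) (Sum.inl β))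
          + ∑ ρ' : Fin (d + 1), ∑' w : Site (d + 1),
            colM (coDressKBmAt (toSite (ctrOff (d + 1) Lc)) Lc (KInvStep (d := d) Lc (j + 1))) Lc ν y' ρ' w
              * ((if y' + Pi.single ν 1 = y then (1 / 2 : ℝ) else 0) - (if w + Pi.single ρ' 1 = y then (1 / 2 : ℝ) else 0))
              * ∑' xz : Site (d + 1) × Site (d + 1), ((if xz.1 α % (Lc : ℤ) = (Lc : ℤ) - 1 then (1 : ℝ) else 0) * (if xz.2 β % (Lc : ℤ) = (Lc : ℤ) - 1 then (1 : ℝ) else 0))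
            * M1At d Lc (toSite (ctrOff (d + 1) Lc)) cΛ (j + 1) ρ' w xz.1 xz.2 (Sum.inl α) (Sum.inl β))))
    (hQc : ∀ y' : Site (d + 1), Qc y' = (∑ κ : Fin (d + 1), ∑' u : Site (d + 1),
        (∑' x₂, ∑ κ₂, comp (coDressKBmAt (toSite (ctrOff (d + 1) Lc)) Lc (KInvStep (d := d) Lc (j + 1)))
            (dM (coDressKBmAt (toSite (ctrOff (d + 1) Lc)) Lc (KInvStep (d := d) Lc (j + 1))) Lc (SpureRecAt d Lc (toSite (ctrOff (d + 1) Lc)) cE cVH cΛ (j + 1)) (M1At d Lc (toSite (ctrOff (d + 1) Lc)) cΛ (j + 1)) ν y')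
            u x₂ (Sum.inl κ) (Sum.inl κ₂) * gaugeWt Lc y κ₂ x₂)
          * ∑' xz : Site (d + 1) × Site (d + 1), ((if xz.1 α % (Lc : ℤ) = (Lc : ℤ) - 1 then (1 : ℝ) else 0) * (if xz.2 β % (Lc : ℤ) = (Lc : ℤ) - 1 then (1 : ℝ) else 0))
            * SpureRecAt d Lc (toSite (ctrOff (d + 1) Lc)) cE cVH cΛ (j + 1) κ u xz.1 xz.2 (Sum.inl α) (Sum.inl β)
      + ∑ ρ' : Fin (d + 1), ∑' w : Site (d + 1),
        (∑' x₂, ∑ κ₂, comp (coDressKBmAt (toSite (ctrOff (d + 1) Lc)) Lc (KInvStep (d := d) Lc (j + 1)))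
            (dM (coDressKBmAt (toSite (ctrOff (d + 1) Lc)) Lc (KInvStep (d := d) Lc (j + 1))) Lc (SpureRecAt d Lc (toSite (ctrOff (d + 1) Lc)) cE cVH cΛ (j + 1)) (M1At d Lc (toSite (ctrOff (d + 1) Lc)) cΛ (j + 1)) ν y')
            ((Lc : ℤ) • w) x₂ (Sum.inr ρ') (Sum.inl κ₂) * gaugeWt Lc y κ₂ x₂)
          * ∑' xz : Site (d + 1) × Site (d + 1), ((if xz.1 α % (Lc : ℤ) = (Lc : ℤ) - 1 then (1 : ℝ) else 0) * (if xz.2 β % (Lc : ℤ) = (Lc : ℤ) - 1 then (1 : ℝ) else 0))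
            * M1At d Lc (toSite (ctrOff (d + 1) Lc)) cΛ (j + 1) ρ' w xz.1 xz.2 (Sum.inl α) (Sum.inl β)))
    (hX : ∀ (y' : Site (d + 1)) (c : ℝ), (∀ (ν : Fin (d + 1)) (y' : Site (d + 1)), ∑' xz : Site (d + 1) × Site (d + 1),
        (if xz.1 α % (Lc : ℤ) = (Lc : ℤ) - 1 then (1 : ℝ) else 0) * (if xz.2 β % (Lc : ℤ) = (Lc : ℤ) - 1 then (1 : ℝ) else 0)
          * SpureRecAt d Lc (toSite (ctrOff (d + 1) Lc)) cE cVH cΛ (j + 1) ν y' xz.1 xz.2 (Sum.inl α) (Sum.inl β)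
        = wVH d Lc (j + 1) * ∑' v, ∑ l : Fin (d + 1), wΦ (N := Lc ^ (j + 1)) ν l (y' - v) * (c * axProjAt (toSite (ctrOff (d + 1) Lc)) Lc
            (fun l x => (if l = α then ((Lc : ℝ) ^ 2)⁻¹ * (((x β % (Lc : ℤ) : ℤ)) : ℝ) else 0)
              - (if l = β then (Lc : ℝ)⁻¹ * (if x β % (Lc : ℤ) = (Lc : ℤ) - 1 then (1 : ℝ) else 0) * (((x α % (Lc : ℤ) : ℤ)) : ℝ) else 0)) l v)) →
      (cE * wE d Lc (j + 1)) * (∑ l, ∑' t, colH (coDressKBmAt (toSite (ctrOff (d + 1) Lc)) Lc (KInvStep (d := d) Lc (j + 1))) Lc ν y' l t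
          * ∑' ux : Site (d + 1) × Site (d + 1), ∑ κ, ∑ κ₂,
              (axProjAt (toSite (ctrOff (d + 1) Lc)) Lc
                  (fun l v => c * axProjAt (toSite (ctrOff (d + 1) Lc)) Lc
                (fun l x => (if l = α then ((Lc : ℝ) ^ 2)⁻¹ * (((x β % (Lc : ℤ) : ℤ)) : ℝ) else 0)
              - (if l = β then (Lc : ℝ)⁻¹ * (if x β % (Lc : ℤ) = (Lc : ℤ) - 1 then (1 : ℝ) else 0) * (((x α % (Lc : ℤ) : ℤ)) : ℝ) else 0)) l v) κ ux.1
                - ((Lc : ℝ) ^ (d + 1))⁻¹ * (contourSum Lc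
                  (fun l v => c * axProjAt (toSite (ctrOff (d + 1) Lc)) Lc
                (fun l x => (if l = α then ((Lc : ℝ) ^ 2)⁻¹ * (((x β % (Lc : ℤ) : ℤ)) : ℝ) else 0)
              - (if l = β then (Lc : ℝ)⁻¹ * (if x β % (Lc : ℤ) = (Lc : ℤ) - 1 then (1 : ℝ) else 0) * (((x α % (Lc : ℤ) : ℤ)) : ℝ) else 0)) l v) κ 0
                  * (if ux.1 κ % (Lc : ℤ) = (Lc : ℤ) - 1 then (1 : ℝ) else 0)))
              * dz (fun z : Site (d + 1) => if blk Lc z = y then (1 : ℝ) else 0) κ₂ ux.2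
              * e3OfK Lc (coDressKBmAt (toSite (ctrOff (d + 1) Lc)) Lc (KInvStep (d := d) Lc j)) (SrecAt d Lc (toSite (ctrOff (d + 1) Lc)) cE cVH cΛ j) l t ux.1 ux.2 (Sum.inl κ) (Sum.inl κ₂))
        = (-(stepScale d Lc (j + 1) * (Lc : ℝ) ^ (d + 1)) / 2) * ∑' u : Site (d + 1), ∑ κ : Fin (d + 1), (if blk Lc (u + Pi.single κ 1) = y then (1 : ℝ) else 0)
            * colH (coDressKBmAt (toSite (ctrOff (d + 1) Lc)) Lc (KInvStep (d := d) Lc (j + 1))) Lc ν y' κ u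
            * ∑' xz : Site (d + 1) × Site (d + 1), ((if xz.1 α % (Lc : ℤ) = (Lc : ℤ) - 1 then (1 : ℝ) else 0) * (if xz.2 β % (Lc : ℤ) = (Lc : ℤ) - 1 then (1 : ℝ) else 0))
            * SpureRecAt d Lc (toSite (ctrOff (d + 1) Lc)) cE cVH cΛ (j + 1) κ u xz.1 xz.2 (Sum.inl α) (Sum.inl β)) :
    (∑' y' : Site (d + 1), (Vα y' - (1 / 2 : ℝ) * (stepScale d Lc (j + 1) * (Lc : ℝ) ^ (d + 1))⁻¹ * Qc y') = 0)
      ∧ ∀ lam : Fin (d + 1),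
        ∑' y' : Site (d + 1), (((y' - y) lam : ℤ) : ℝ) * (Vα y' - (1 / 2 : ℝ) * (stepScale d Lc (j + 1) * (Lc : ℝ) ^ (d + 1))⁻¹ * Qc y') = 0 := by
  have hLc1 : 1 ≤ Lc := hLc.pos
  have h0 : ∀ (c : ℝ) (w : Site (d + 1)) (κ : Fin (d + 1)),
      contourSum Lc (fun κ u => ((if blk Lc u = y then (1 : ℝ) else 0) + (if blk Lc (u + unitVec κ) = y then (1 : ℝ) else 0))
        * (axProjAt (toSite (ctrOff (d + 1) Lc)) Lc
            (fun l v => c * axProjAt (toSite (ctrOff (d + 1) Lc)) Lc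
              (fun l x => (if l = α then ((Lc : ℝ) ^ 2)⁻¹ * (((x β % (Lc : ℤ) : ℤ)) : ℝ) else 0)
                - (if l = β then (Lc : ℝ)⁻¹ * (if x β % (Lc : ℤ) = (Lc : ℤ) - 1 then (1 : ℝ) else 0) * (((x α % (Lc : ℤ) : ℤ)) : ℝ) else 0)) l v) κ u
          - ((Lc : ℝ) ^ (d + 1))⁻¹ * (contourSum Lc
            (fun l v => c * axProjAt (toSite (ctrOff (d + 1) Lc)) Lc
              (fun l x => (if l = α then ((Lc : ℝ) ^ 2)⁻¹ * (((x β % (Lc : ℤ) : ℤ)) : ℝ) else 0)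
                - (if l = β then (Lc : ℝ)⁻¹ * (if x β % (Lc : ℤ) = (Lc : ℤ) - 1 then (1 : ℝ) else 0) * (((x α % (Lc : ℤ) : ℤ)) : ℝ) else 0)) l v) κ 0
            * (if u κ % (Lc : ℤ) = (Lc : ℤ) - 1 then (1 : ℝ) else 0)))) κ w = 0 :=
    fun c w κ => contourSum_bondSum_blockInd_explicitSourceForm_eq_zero (ctrOff_mem_box hLc1) hαβ c y κ w
  refine moments_sigmaPair_exit_succ_of_reducedPairing hLc cE cVH cΛ j y ν hαβ hVα hVend hQc fun y' c hT => ?_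
  simp only [h0, zero_mul, Finset.sum_const_zero, tsum_zero, mul_zero, sub_zero]
  exact hX y' c hT

end Srow

end Summit.QuantumFields.BalabanUV.Beta.GAN24.ExplicitSourceFormLambdaShare

end
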